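import Summits.Ventures.PercRepro.RankLevelSetRuleQCellTwo

/-!
# PercRepro — THE BINOMIAL ARITHMETIC OF THE CELL `(q+3, q)`: the two-term geometric tail, `S₁` in closed form,
the first four terms of `S₂`, and the one rational inequality (night-1, gen 16; dossier §27)

Companion of RankLevelSetRuleQCellThree (which assembles these into `RhatCell q 3`). With `s = m − 2`, `t = q − m − 2`:
* `sum_choose_tail_two` — `(x+1)·Σ_{i ≤ j} C(2j+x, i) ≤ (j+x+1)·C(2j+x, j)` (the ratio `i/(n−i+1)` is at most `j/(n−j+1)`
  below `j`; sharper than RankLevelSetRuleQCellTwo's `geom_tail`, which does not suffice here);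
* `cellTwo_sum_eq` — `Σ_{a ≤ m} C(m, a)/C(q+1+a, a+1) = ((m+1)·C − v·P)/(C·(q+m+1))` (`q = m + v + 1`, `C = C(q+m, m)`,
  `P = Σ_{i < m} C(q+m, i)`; the identities of RankLevelSetRuleQCellTwo, kept as an equation);
* `sum_range_choose_le_two` / `choose_pred_ratios` — `P ≤ C(n, m−1) + C(n, m−2)·(q+3)/(v+6)` and the two ratios below `C(n, m)`;
* `cellThree_S2_trunc`, `choose_small_values`, `choose_two_three_values` — the first four terms of `S₂` with their binomials;
* **`cellThree_poly`** — the one rational inequality: `2(q+3)/(q+1) ≤ (t+5)·((m+1) − (t+1)·ρ̂)/(q+m+1) + C(t+5,2)·(first four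
  terms of S₂)`, `ρ̂ = m/(q+1) + m(m−1)(q+3)/((q+1)(q+2)(t+7))`; after clearing denominators a polynomial of degree 7 in
  `s, t` with 34 terms, all coefficients nonnegative except `−18·s⁵`, absorbed by `2s⁴(s − 9/2)²` (`s⁶`: 4, `s⁴`: 7,948).
Twin: mining/night-1/g16/k3poly.py (the polynomial, exact), k3combo2.py (the inequality on every cell `q ≤ 400`, 0 failures).
Axioms: standard.
-/

namespace PercRepro

open Finset

/-! ### §1 The two-term geometric tail -/

/-- **The geometric tail of a binomial row, sharp form**: `(x+1)·Σ_{i ≤ j} C(2j+x, i) ≤ (j+x+1)·C(2j+x, j)`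
(the ratio `C(n, i−1)/C(n, i) = i/(n−i+1)` is at most `j/(n−j+1)` below `j`; induction on `j`). -/
lemma sum_choose_tail_two : ∀ j x : ℕ,
    (x + 1) * ∑ i ∈ range (j + 1), (2 * j + x).choose i ≤ (j + x + 1) * (2 * j + x).choose j := by
  intro j
  induction j with
  | zero => intro x; simp
  | succ j ih =>
    intro x
    have ih' := ih (x + 2)
    rw [show 2 * j + (x + 2) = 2 * (j + 1) + x by ring] at ih'
    have hc := Nat.choose_succ_right_eq (2 * (j + 1) + x) j
    rw [show 2 * (j + 1) + x - j = j + x + 2 by omega] at hc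
    rw [Finset.sum_range_succ]
    set A := ∑ i ∈ range (j + 1), (2 * (j + 1) + x).choose i with hA
    set c := (2 * (j + 1) + x).choose j with hcdef
    set c' := (2 * (j + 1) + x).choose (j + 1) with hc'def
    -- goal: (x + 1) * (A + c') ≤ (j + 1 + x + 1) * c'
    -- from ih' : (x + 3) * A ≤ (j + x + 3) * c  and  hc : c' * (j + 1) = c * (j + x + 2)
    have h1 : (x + 3) * ((x + 1) * A) ≤ (x + 3) * ((j + 1) * c') := by
      calc (x + 3) * ((x + 1) * A) = (x + 1) * ((x + 3) * A) := by ring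
        _ ≤ (x + 1) * ((j + x + 3) * c) := Nat.mul_le_mul_left _ ih'
        _ = ((x + 1) * (j + x + 3)) * c := by ring
        _ ≤ ((x + 3) * (j + x + 2)) * c := Nat.mul_le_mul_right c (by nlinarith)
        _ = (x + 3) * (c * (j + x + 2)) := by ring
        _ = (x + 3) * (c' * (j + 1)) := by rw [hc]
        _ = (x + 3) * ((j + 1) * c') := by ring
    have h2 : (x + 1) * A ≤ (j + 1) * c' := Nat.le_of_mul_le_mul_left h1 (by omega)
    calc (x + 1) * (A + c') = (x + 1) * A + (x + 1) * c' := by ring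
      _ ≤ (j + 1) * c' + (x + 1) * c' := Nat.add_le_add_right h2 _
      _ = (j + 1 + x + 1) * c' := by ring


/-! ### §2 The slice sum `S₁` in closed form, and its two-term tail bound -/

/-- **`S₁` in closed form** (`q = m + v + 1`): `Σ_{a ≤ m} C(m, a)/C(q+1+a, a+1) = ((m+1)·C − v·P)/(C·(q+m+1))` with
`C = C(q+m, m)`, `P = Σ_{i < m} C(q+m, i)` (the two identities of RankLevelSetRuleQCellTwo). -/
lemma cellTwo_sum_eq (m v : ℕ) :
    ∑ a ∈ range (m + 1), (m.choose a : ℚ) / ((m + v + 1 + 1 + a).choose (a + 1) : ℚ)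
      = (((m : ℚ) + 1) * ((m + v + 1 + m).choose m : ℚ)
          - (v : ℚ) * ∑ i ∈ range m, ((m + v + 1 + m).choose i : ℚ))
        / (((m + v + 1 + m).choose m : ℚ) * (m + v + 1 + m + 1)) := by
  have hsplit : ∑ a ∈ range (m + 1), (m.choose a : ℚ) / ((m + v + 1 + 1 + a).choose (a + 1) : ℚ)
      = ∑ a ∈ range (m + 1), (m.choose a : ℚ) / ((m + v + 1 + a).choose a : ℚ)
        - ((m : ℚ) + v + 1) / ((m : ℚ) + v + 1 + 1)
          * ∑ a ∈ range (m + 1), (m.choose a : ℚ) / ((m + v + 1 + 1 + a).choose a : ℚ) := by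
    rw [Finset.mul_sum, ← Finset.sum_sub_distrib]
    refine Finset.sum_congr rfl (fun a _ => ?_)
    have h := one_div_choose_succ_eq (m + v + 1) a
    push_cast at h
    calc (m.choose a : ℚ) / ((m + v + 1 + 1 + a).choose (a + 1) : ℚ)
        = (m.choose a : ℚ) * (1 / ((m + v + 1 + 1 + a).choose (a + 1) : ℚ)) := by ring
      _ = (m.choose a : ℚ) * (1 / ((m + v + 1 + a).choose a : ℚ)
            - ((m : ℚ) + v + 1) / ((m : ℚ) + v + 1 + 1) * (1 / ((m + v + 1 + 1 + a).choose a : ℚ))) := by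
          rw [h]
      _ = _ := by ring
  rw [hsplit, sum_choose_div_choose_eq, sum_choose_div_choose_eq]
  have hP := sum_choose_succ_eq (m + v + 1 + m) m
  rw [Finset.sum_range_succ (fun i => (m + v + 1 + m).choose i) m] at hP
  rw [show m + v + 1 + 1 + m = m + v + 1 + m + 1 by ring,
    Finset.sum_range_succ (fun i => ((m + v + 1 + m).choose i : ℚ)) m]
  have hPsum : (∑ i ∈ range (m + 1), ((m + v + 1 + m + 1).choose i : ℚ))
      = 2 * (∑ i ∈ range m, ((m + v + 1 + m).choose i : ℚ)) + ((m + v + 1 + m).choose m : ℚ) := by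
    have h' : ((∑ i ∈ range (m + 1), (m + v + 1 + m + 1).choose i : ℕ) : ℚ)
        = ((∑ i ∈ range m, (m + v + 1 + m).choose i + (m + v + 1 + m).choose m
            + ∑ i ∈ range m, (m + v + 1 + m).choose i : ℕ) : ℚ) := by rw [hP]
    push_cast at h'
    rw [h']; ring
  rw [hPsum]
  set C := (m + v + 1 + m).choose m with hC
  set D := (m + v + 1 + m + 1).choose m with hD
  set P := ∑ i ∈ range m, ((m + v + 1 + m).choose i : ℚ) with hPdef
  have hDC : (D : ℚ) * (m + v + 1 + 1) = (C : ℚ) * (m + v + 1 + m + 1) := by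
    have h := Nat.choose_mul_succ_eq (m + v + 1 + m) m
    rw [show m + v + 1 + m + 1 - m = m + v + 1 + 1 by omega] at h
    exact_mod_cast h.symm
  have hCpos : (0 : ℚ) < C := by exact_mod_cast Nat.choose_pos (by omega)
  have hDval : (D : ℚ) = C * (m + v + 1 + m + 1) / (m + v + 1 + 1) := by
    rw [eq_div_iff (by positivity)]; exact hDC
  rw [hDval]
  field_simp
  ring

/-- **The two-term tail bound on `P`** (`m = s + 2`, `q = m + v + 1`, `n = q + m`):
`Σ_{i < m} C(n, i) ≤ C(n, m−1) + C(n, m−2)·(q+3)/(v+6)`, from `sum_choose_tail_two`. -/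
lemma sum_range_choose_le_two (s v : ℕ) :
    (∑ i ∈ range (s + 2), ((s + 2 + v + 1 + (s + 2)).choose i : ℚ))
      ≤ ((s + 2 + v + 1 + (s + 2)).choose (s + 1) : ℚ)
        + ((s + 2 + v + 1 + (s + 2)).choose s : ℚ) * ((s : ℚ) + v + 6) / ((v : ℚ) + 6) := by
  have h := sum_choose_tail_two s (v + 5)
  rw [show 2 * s + (v + 5) = s + 2 + v + 1 + (s + 2) by ring] at h
  have h' : ((v : ℚ) + 6) * ∑ i ∈ range (s + 1), ((s + 2 + v + 1 + (s + 2)).choose i : ℚ)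
      ≤ ((s : ℚ) + v + 6) * ((s + 2 + v + 1 + (s + 2)).choose s : ℚ) := by
    have : (((v + 5 + 1) * ∑ i ∈ range (s + 1), (s + 2 + v + 1 + (s + 2)).choose i : ℕ) : ℚ)
        ≤ (((s + (v + 5) + 1) * (s + 2 + v + 1 + (s + 2)).choose s : ℕ) : ℚ) := by exact_mod_cast h
    push_cast at this
    linarith [this]
  rw [Finset.sum_range_succ]
  have hv : (0 : ℚ) < (v : ℚ) + 6 := by positivity
  have : ∑ i ∈ range (s + 1), ((s + 2 + v + 1 + (s + 2)).choose i : ℚ)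
      ≤ ((s + 2 + v + 1 + (s + 2)).choose s : ℚ) * ((s : ℚ) + v + 6) / ((v : ℚ) + 6) := by
    rw [le_div_iff₀ hv]; linarith [h']
  linarith [this]

/-- The two binomial ratios below `C(n, m)`: `C(n, m−1)·(q+1) = C(n, m)·m` and `C(n, m−2)·(q+2) = C(n, m−1)·(m−1)`
(`m = s + 2`, `n = q + m`). -/
lemma choose_pred_ratios (s v : ℕ) :
    ((s + 2 + v + 1 + (s + 2)).choose (s + 1) : ℚ) * ((s : ℚ) + v + 4)
        = ((s + 2 + v + 1 + (s + 2)).choose (s + 2) : ℚ) * ((s : ℚ) + 2)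
    ∧ ((s + 2 + v + 1 + (s + 2)).choose s : ℚ) * ((s : ℚ) + v + 5)
        = ((s + 2 + v + 1 + (s + 2)).choose (s + 1) : ℚ) * ((s : ℚ) + 1) := by
  constructor
  · have h := Nat.choose_succ_right_eq (s + 2 + v + 1 + (s + 2)) (s + 1)
    rw [show s + 2 + v + 1 + (s + 2) - (s + 1) = s + v + 4 by omega] at h
    have h' : (((s + 2 + v + 1 + (s + 2)).choose (s + 1 + 1) * (s + 1 + 1) : ℕ) : ℚ)
        = (((s + 2 + v + 1 + (s + 2)).choose (s + 1) * (s + v + 4) : ℕ) : ℚ) := by rw [h]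
    push_cast at h'
    linear_combination -h'
  · have h := Nat.choose_succ_right_eq (s + 2 + v + 1 + (s + 2)) s
    rw [show s + 2 + v + 1 + (s + 2) - s = s + v + 5 by omega] at h
    have h' : (((s + 2 + v + 1 + (s + 2)).choose (s + 1) * (s + 1) : ℕ) : ℚ)
        = (((s + 2 + v + 1 + (s + 2)).choose s * (s + v + 5) : ℕ) : ℚ) := by rw [h]
    push_cast at h'
    linear_combination -h'


/-! ### §3 The first four terms of `S₂` -/

/-- `S₂ ≥` its terms `a ≤ 3` (all terms are nonnegative; for `m = 2` the term `a = 3` vanishes). -/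
lemma cellThree_S2_trunc (q m : ℕ) (hm : 2 ≤ m) :
    ∑ a ∈ range 4, (m.choose a : ℚ) / ((q + 2 + a).choose (a + 2) : ℚ)
      ≤ ∑ a ∈ range (m + 1), (m.choose a : ℚ) / ((q + 2 + a).choose (a + 2) : ℚ) := by
  rcases Nat.lt_or_ge m 3 with hlt | hge
  · have hm2 : m = 2 := by omega
    subst hm2
    rw [Finset.sum_range_succ (fun a => ((2 : ℕ).choose a : ℚ) / ((q + 2 + a).choose (a + 2) : ℚ)) 3]
    simp
  · apply Finset.sum_le_sum_of_subset_of_nonneg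
    · intro a ha
      rw [Finset.mem_range] at ha ⊢
      omega
    · intros; positivity

/-- The binomials of the first four terms of `S₂`, as rationals (in the shapes `C(q+2+a, a+2)`). -/
lemma choose_small_values (q : ℕ) :
    ((q + 2).choose 2 : ℚ) * 2 = (q + 2) * (q + 1)
    ∧ ((q + 2 + 1).choose 3 : ℚ) * 6 = (q + 3) * (q + 2) * (q + 1)
    ∧ ((q + 2 + 2).choose 4 : ℚ) * 24 = (q + 4) * (q + 3) * (q + 2) * (q + 1)
    ∧ ((q + 2 + 3).choose 5 : ℚ) * 120 = (q + 5) * (q + 4) * (q + 3) * (q + 2) * (q + 1) := by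
  have e1 := Nat.add_one_mul_choose_eq (q + 1) 1
  have e2 := Nat.add_one_mul_choose_eq (q + 2) 2
  have e3 := Nat.add_one_mul_choose_eq (q + 3) 3
  have e4 := Nat.add_one_mul_choose_eq (q + 4) 4
  rw [Nat.choose_one_right] at e1
  have f1 : ((q + 2).choose 2 : ℚ) * 2 = (q + 2) * (q + 1) := by exact_mod_cast e1.symm
  have f2 : ((q + 2 + 1).choose 3 : ℚ) * 3 = (q + 3) * ((q + 2).choose 2 : ℚ) := by exact_mod_cast e2.symm
  have f3 : ((q + 2 + 2).choose 4 : ℚ) * 4 = (q + 4) * ((q + 2 + 1).choose 3 : ℚ) := by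
    rw [show q + 2 + 2 = q + 3 + 1 by ring, show q + 2 + 1 = q + 3 by ring]; exact_mod_cast e3.symm
  have f4 : ((q + 2 + 3).choose 5 : ℚ) * 5 = (q + 5) * ((q + 2 + 2).choose 4 : ℚ) := by
    rw [show q + 2 + 3 = q + 4 + 1 by ring, show q + 2 + 2 = q + 4 by ring]; exact_mod_cast e4.symm
  refine ⟨f1, ?_, ?_, ?_⟩
  · linear_combination 2 * f2 + (q + 3 : ℚ) * f1
  · linear_combination 6 * f3 + 2 * (q + 4 : ℚ) * f2 + (q + 4 : ℚ) * (q + 3) * f1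
  · linear_combination 24 * f4 + 6 * (q + 5 : ℚ) * f3 + 2 * (q + 5 : ℚ) * (q + 4) * f2
      + (q + 5 : ℚ) * (q + 4) * (q + 3) * f1

/-- `C(m, 2)·2 = m(m−1)` and `C(m, 3)·6 = m(m−1)(m−2)` for `m = s + 2`, as rationals. -/
lemma choose_two_three_values (s : ℕ) :
    (((s + 2).choose 2 : ℕ) : ℚ) * 2 = (s + 2) * (s + 1)
    ∧ (((s + 2).choose 3 : ℕ) : ℚ) * 6 = (s + 2) * (s + 1) * s := by
  have e1 := Nat.add_one_mul_choose_eq (s + 1) 1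
  have e2 := Nat.add_one_mul_choose_eq (s + 1) 2
  rw [Nat.choose_one_right] at e1
  have f1 : (((s + 2).choose 2 : ℕ) : ℚ) * 2 = (s + 2) * (s + 1) := by exact_mod_cast e1.symm
  have f2 : (((s + 2).choose 3 : ℕ) : ℚ) * 3 = (s + 2) * (((s + 1).choose 2 : ℕ) : ℚ) := by exact_mod_cast e2.symm
  have e0 := Nat.add_one_mul_choose_eq s 1
  rw [Nat.choose_one_right] at e0
  have f0 : (((s + 1).choose 2 : ℕ) : ℚ) * 2 = (s + 1) * s := by exact_mod_cast e0.symm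
  refine ⟨f1, ?_⟩
  linear_combination 2 * f2 + (s + 2 : ℚ) * f0


/-! ### §4 The one rational inequality -/

/-- The one rational inequality of the cell `(q+3, q)`, `q = s + t + 4`, `m = s + 2`, `v = t + 1`. -/
lemma cellThree_poly (s t : ℕ) :
    2 * ((s : ℚ) + t + 4 + 3) / ((s : ℚ) + t + 4 + 1)
      ≤ ((t : ℚ) + 5) * ((((s : ℚ) + 2) + 1
            - ((t : ℚ) + 1) * (((s : ℚ) + 2) / ((s : ℚ) + t + 4 + 1)
                + ((s : ℚ) + 2) * ((s : ℚ) + 1) * ((s : ℚ) + t + 4 + 3)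
                  / (((s : ℚ) + t + 4 + 1) * ((s : ℚ) + t + 4 + 2) * ((t : ℚ) + 7))))
            / ((s : ℚ) + t + 4 + (s + 2) + 1))
        + ((t : ℚ) + 5) * ((t : ℚ) + 4) / 2
          * (2 / (((s : ℚ) + t + 4 + 2) * ((s : ℚ) + t + 4 + 1))
            + 6 * ((s : ℚ) + 2) / (((s : ℚ) + t + 4 + 3) * ((s : ℚ) + t + 4 + 2) * ((s : ℚ) + t + 4 + 1))
            + 12 * ((s : ℚ) + 2) * ((s : ℚ) + 1)
              / (((s : ℚ) + t + 4 + 4) * ((s : ℚ) + t + 4 + 3) * ((s : ℚ) + t + 4 + 2) * ((s : ℚ) + t + 4 + 1))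
            + 20 * ((s : ℚ) + 2) * ((s : ℚ) + 1) * s
              / (((s : ℚ) + t + 4 + 5) * ((s : ℚ) + t + 4 + 4) * ((s : ℚ) + t + 4 + 3) * ((s : ℚ) + t + 4 + 2)
                  * ((s : ℚ) + t + 4 + 1))) := by
  have hs : (0 : ℚ) ≤ s := by positivity
  have ht : (0 : ℚ) ≤ t := by positivity
  have hM : (0 : ℚ) ≤ (578592 : ℚ) + (596512 : ℚ) * t + (242808 : ℚ) * t ^ 2 + (50576 : ℚ) * t ^ 3 + (5728 : ℚ) * t ^ 4 + (336 : ℚ) * t ^ 5 + (8 : ℚ) * t ^ 6 + (761208 : ℚ) * s + (732052 : ℚ) * s * t + (269672 : ℚ) * s * t ^ 2 + (49324 : ℚ) * s * t ^ 3 + (4732 : ℚ) * s * t ^ 4 + (224 : ℚ) * s * t ^ 5 + (4 : ℚ) * s * t ^ 6 + (380536 : ℚ) * s ^ 2 + (335118 : ℚ) * s ^ 2 * t + (106886 : ℚ) * s ^ 2 * t ^ 2 + (15798 : ℚ) * s ^ 2 * t ^ 3 + (1090 : ℚ) * s ^ 2 * t ^ 4 + (28 : ℚ) * s ^ 2 *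 t ^ 5 + (88290 : ℚ) * s ^ 3 + (71118 : ℚ) * s ^ 3 * t + (18880 : ℚ) * s ^ 3 * t ^ 2 + (2050 : ℚ) * s ^ 3 * t ^ 3 + (78 : ℚ) * s ^ 3 * t ^ 4 + (15815/2 : ℚ) * s ^ 4 + (6164 : ℚ) * s ^ 4 * t + (1272 : ℚ) * s ^ 4 * t ^ 2 + (80 : ℚ) * s ^ 4 * t ^ 3 + (88 : ℚ) * s ^ 5 * t + (10 : ℚ) * s ^ 5 * t ^ 2 + (2 : ℚ) * s ^ 6 + (4 : ℚ) * s ^ 6 * t := by positivity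
  have hsq : (0 : ℚ) ≤ 2 * (s : ℚ) ^ 4 * ((s : ℚ) - 9 / 2) ^ 2 := by positivity
  have key : ((t : ℚ) + 5) * ((((s : ℚ) + 2) + 1
            - ((t : ℚ) + 1) * (((s : ℚ) + 2) / ((s : ℚ) + t + 4 + 1)
                + ((s : ℚ) + 2) * ((s : ℚ) + 1) * ((s : ℚ) + t + 4 + 3)
                  / (((s : ℚ) + t + 4 + 1) * ((s : ℚ) + t + 4 + 2) * ((t : ℚ) + 7))))
            / ((s : ℚ) + t + 4 + (s + 2) + 1))
        + ((t : ℚ) + 5) * ((t : ℚ) + 4) / 2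
          * (2 / (((s : ℚ) + t + 4 + 2) * ((s : ℚ) + t + 4 + 1))
            + 6 * ((s : ℚ) + 2) / (((s : ℚ) + t + 4 + 3) * ((s : ℚ) + t + 4 + 2) * ((s : ℚ) + t + 4 + 1))
            + 12 * ((s : ℚ) + 2) * ((s : ℚ) + 1)
              / (((s : ℚ) + t + 4 + 4) * ((s : ℚ) + t + 4 + 3) * ((s : ℚ) + t + 4 + 2) * ((s : ℚ) + t + 4 + 1))
            + 20 * ((s : ℚ) + 2) * ((s : ℚ) + 1) * s
              / (((s : ℚ) + t + 4 + 5) * ((s : ℚ) + t + 4 + 4) * ((s : ℚ) + t + 4 + 3) * ((s : ℚ) + t + 4 + 2)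
                  * ((s : ℚ) + t + 4 + 1)))
      - 2 * ((s : ℚ) + t + 4 + 3) / ((s : ℚ) + t + 4 + 1)
      = (((578592 : ℚ) + (596512 : ℚ) * t + (242808 : ℚ) * t ^ 2 + (50576 : ℚ) * t ^ 3 + (5728 : ℚ) * t ^ 4 + (336 : ℚ) * t ^ 5 + (8 : ℚ) * t ^ 6 + (761208 : ℚ) * s + (732052 : ℚ) * s * t + (269672 : ℚ) * s * t ^ 2 + (49324 : ℚ) * s * t ^ 3 + (4732 : ℚ) * s * t ^ 4 + (224 : ℚ) * s * t ^ 5 + (4 : ℚ) * s * t ^ 6 + (380536 : ℚ) * s ^ 2 + (335118 : ℚ) * s ^ 2 * t + (106886 : ℚ) * s ^ 2 * t ^ 2 + (15798 : ℚ) * s ^ 2 * t ^ 3 + (1090 : ℚ) * s ^ 2 * t ^ 4 + (28 : ℚ) * s ^ 2 * t ^ 5 + (88290 : ℚ) * s ^ 3 + (71118 : ℚ) * s ^ 3 * t + (18880 : ℚ) * s ^ 3 * t ^ 2 + (2050 : ℚ) * s ^ 3 * t ^ 3 + (78 : ℚ) * s ^ 3 * t ^ 4 + (15815/2 : ℚ)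 * s ^ 4 + (6164 : ℚ) * s ^ 4 * t + (1272 : ℚ) * s ^ 4 * t ^ 2 + (80 : ℚ) * s ^ 4 * t ^ 3 + (88 : ℚ) * s ^ 5 * t + (10 : ℚ) * s ^ 5 * t ^ 2 + (2 : ℚ) * s ^ 6 + (4 : ℚ) * s ^ 6 * t) + 2 * (s : ℚ) ^ 4 * ((s : ℚ) - 9 / 2) ^ 2)
        / (2 * ((s : ℚ) + t + 4 + (s + 2) + 1) * ((s : ℚ) + t + 4 + 1) * ((s : ℚ) + t + 4 + 2)
            * ((s : ℚ) + t + 4 + 3) * ((s : ℚ) + t + 4 + 4) * ((s : ℚ) + t + 4 + 5) * ((t : ℚ) + 7)) := by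
    field_simp
    ring
  have hnn : 0 ≤ (((578592 : ℚ) + (596512 : ℚ) * t + (242808 : ℚ) * t ^ 2 + (50576 : ℚ) * t ^ 3 + (5728 : ℚ) * t ^ 4 + (336 : ℚ) * t ^ 5 + (8 : ℚ) * t ^ 6 + (761208 : ℚ) * s + (732052 : ℚ) * s * t + (269672 : ℚ) * s * t ^ 2 + (49324 : ℚ) * s * t ^ 3 + (4732 : ℚ) * s * t ^ 4 + (224 : ℚ) * s * t ^ 5 + (4 : ℚ) * s * t ^ 6 + (380536 : ℚ) * s ^ 2 + (335118 : ℚ) * s ^ 2 * t + (106886 : ℚ) * s ^ 2 * t ^ 2 + (15798 : ℚ) * s ^ 2 * t ^ 3 + (1090 : ℚ) * s ^ 2 * t ^ 4 + (28 : ℚ) * s ^ 2 * t ^ 5 + (88290 : ℚ) * s ^ 3 + (71118 : ℚ) * s ^ 3 * t + (18880 : ℚ) * s ^ 3 * t ^ 2 + (2050 : ℚ) * s ^ 3 * t ^ 3 + (78 : ℚ) * s ^ 3 * t ^ 4 + (15815/2 : ℚ) * s ^ 4 + (6164 : ℚ) * s ^ 4 * t + (1272 : ℚ) * s ^ 4 *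 t ^ 2 + (80 : ℚ) * s ^ 4 * t ^ 3 + (88 : ℚ) * s ^ 5 * t + (10 : ℚ) * s ^ 5 * t ^ 2 + (2 : ℚ) * s ^ 6 + (4 : ℚ) * s ^ 6 * t) + 2 * (s : ℚ) ^ 4 * ((s : ℚ) - 9 / 2) ^ 2)
        / (2 * ((s : ℚ) + t + 4 + (s + 2) + 1) * ((s : ℚ) + t + 4 + 1) * ((s : ℚ) + t + 4 + 2)
            * ((s : ℚ) + t + 4 + 3) * ((s : ℚ) + t + 4 + 4) * ((s : ℚ) + t + 4 + 5) * ((t : ℚ) + 7)) :=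
    div_nonneg (add_nonneg hM hsq) (by positivity)
  rw [← key] at hnn
  linarith


end PercRepro
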